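import Mathlib
import Literature.MathematicalPhysics.QuantumFieldTheory.Balaban1983to89.B5DeltaA169
import Literature.MathematicalPhysics.QuantumFieldTheory.Balaban1983to89.B5ToronOperators118

/-!
# B5 (1.29)–(1.31), (1.30), (1.61), (1.26)/(1.70), (1.69) AT A CONSTANT ABELIAN BACKGROUND ("TORON TWINS",
# momentum side): the twisted symbols, the twisted momentum representations of `Q′^ω_k`, `Q^ω_k`, and the
# definitions `Δ_ω⁻¹`, `(Q′^ωΔ_ω⁻²Q′^ω*)⁻¹`, `P^ω`, `Q^ω*`, `Δ^ω_a`

statement-level skeleton of published theorems with citation tags; proofs where landed; nothing here is a claim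
about the Yang–Mills mass gap

Sources.  T. Bałaban, *Propagators and renormalization transformations for lattice gauge theories. I*, Commun.
Math. Phys. **95** (1984) 17–40 [Balaban1984PropagatorsI] ("B5"): (1.26) p. 22, (1.29)–(1.31) p. 23, (1.61) p. 28,
(1.69)–(1.70) pp. 29–30, (1.73)–(1.74) p. 30, (1.83) p. 31.  T. Bałaban, *Propagators for lattice gauge theories in
a background field*, Commun. Math. Phys. **99** (1985) 389–434 [Balaban1985BackgroundPropagators] ("B9"): (3.3) p.
391, (3.19)–(3.25) pp. 393–394 (text layer `paper:balaban1985-cmp99-background-propagators` read this session).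

## What the papers print (verbatim)

[B5] p. 23: «f̃(p) = Σ_{x∈T′_η} η^d e^{−ip·x} f(x), p ∈ T̃′_η (1.29) … Δ(p) = Σ_{μ=1}^d |∂_μ(p)|², ∂_μ(p) =
(e^{iηp_μ} − 1)/η, u_k(p) = Π_μ ∂¹_μ(p′)/∂_μ(p) (1.31) … p ∈ T̃_η is represented as a sum p = p′ + l»; (1.30):
«Σ_l u_k(p′ + l) λ̃(p′ + l) = 0»; p. 28 (1.61): «(Q_kA)~_μ(p′) = Σ_l u(p′+l) v_μ(p′+l) Ã_μ(p′+l), v_μ(p) =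
∂¹_μ(p′)/∂_μ(p)»; p. 22: «by Δ⁻¹ we denote its inverse on this subspace. We extend it to the whole space by
linearity, putting its value on constant functions equal to 0»; p. 30 (1.70): «P = Δ⁻¹Q′*(Q′Δ⁻²Q′*)⁻¹Q′Δ⁻¹»;
p. 29 (1.69): «⟨A, Δ_aA⟩ = ⟨A, ΔA⟩ − ⟨A, ∂P∂*A⟩ + a⟨A, Q*QA⟩».
[B9] p. 394: «Rf = (I − G′Q′*(Q′G′²Q′*)⁻¹Q′G′)f, (3.25)»; p. 395: «It coincides with Δ_a in (2.19) [of
Propagators II] if U = 1».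

## What this module types and certifies (kernel-checked, 0 `sorry`)

The companion file `B5ToronOperators118` typed the position-space letters with the lattice translation `S_ν`
replaced by `ω_νS_ν` (`ω : Fin d → ℂ`).  Here:
* §1 (any torus `N`, any `ω`): the characters `x ↦ e^{ip·x}` REMAIN eigenvectors of every twisted letter — only
  the symbol shifts: `dft_mul_sdiffTw` (`U∂^ω_ν = diag(ssymTw)U`, `ssymTw N c ω ν p = c(ω_ν e^{ip_ν} − 1)`), its
  adjoint, `dft_mul_LapSTw` (symbol `lsymTw = Σ_ν|ssymTw_ν|²`), `LapSTw_eq`; the twisted `Δ_ω⁻¹ := U^*diag(linvTw)U`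
  with B5's convention «inverse on the subspace, 0 on the kernel» (`LapSinvTw`, `PkerTw`, `LapSTw_mul_LapSinvTw`),
  and the vector-field multipliers `dftV_mul_fdiffTw`, `fdiffTw_eq`, `star_fdiffTw_eq`; every letter has its `ω = 1`
  recovery lemma.
* §2 (fine torus `Tor (fine n M)`, cosets `p = p′ + l ↔ pOf (k, q)`, any `ω`): the twisted unit factors
  `omTw ω k q ν = ω_ν e^{iη(p′_ν+l_ν)}`, `vTw` (`(1/n)Σ_{t<n} omTw^t`), `uTw = Π_ν vTw_ν`; **`masterTw`**,
  **`dft_QsOpTw`** (twisted (1.30): `(Q′^ωf)^(p′) = c_Q Σ_l uTw(p′+l) f^(p′+l)`), **`dft_QvOpTw`** (twisted (1.61):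
  `(Q^ωA)^_μ(p′) = c_Q Σ_l uTw vTw_μ Â_μ(p′+l)`), `dft_QsOpTw_adjoint` (by unitarity from `dft_QsOpTw`); at `ω = 1`
  these are `B5Block118.dft_QsOp`/`dft_QvOp` (`vTw_one`, `uTw_one`).
* §3 (phases): for a unit twist `ω = twistOf φ`, `ω_ν = e^{iφ_ν}`, every twisted symbol IS the flat symbol of
  (1.31)/(1.61) at the SHIFTED REAL MOMENTUM `s′ = p′ + nφ` (`sOfTw n M φ q = sOf M q + n•φ`):
  **`ssymTw_pOf_twistOf = dSym n k s′`**, `lsymTw_pOf_twistOf = Δ(shiftr n k s′)`, `vTw_twistOf = vSym n k s′`,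
  `uTw_twistOf = uSym n k s′` — so every fibre bound of `B5Prop11Fiber` (arbitrary real momenta) applies.
* §4 (definitions on the fine torus): `QvAdjTw := η^{−d}(Q^ω)ᴴ` (the normalisation of `B5DeltaA169.QvAdj`),
  `MopTw := Q′^ωΔ_ω⁻²Q′^ω*`, its coarse symbol `XsTw` (`dft_MopTw_apply`), `MinvTw := U^*diag((c_Q²XsTw)⁻¹)U` (the
  spectral pseudo-inverse, `0⁻¹ = 0`), `PcTTw := Δ_ω⁻¹Q′^ω*·MinvTw·Q′^ωΔ_ω⁻¹` ((1.70) with transports; = (3.25)'s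
  `G′Q′*(Q′G′²Q′*)⁻¹Q′G′` with `Δ_ω⁻¹` for `G′`), and **`DeltaATw := LapTw − ∂^ω·PcTTw·(∂^ω)ᴴ + a·QvAdjTw·QvOpTw`**
  — the twisted `Δ_a` of (1.69)/(1.73); recovery: `QvAdjTw_one`, `MopTw_one`, **`PcTTw_one`** (the flat
  `(Q′Δ⁻²Q′*)⁻¹` of `B5Substitution125` is `(Mop + C)⁻¹` with `C` the projection on constants; it differs from the
  pseudo-inverse by `C`, which `Q′Δ⁻¹` annihilates — proved in §4), **`DeltaATw_one : DeltaATw n M a 1 = DeltaA n M a`**.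

DECLARED READING / HONEST SCOPE.  (R1) `MinvTw` is the pseudo-inverse in the unit-lattice Fourier basis; for a
twist with `ω_ν^{nM_ν} ≠ 1` for some `ν` ("genuine toron") `MopTw` has no kernel and it is the inverse; when
`ω^n` is a unit-lattice character the one degenerate coset is the twisted image of B5's `p′ = 0` and carries no
`P`-component (as in the flat files).  (R2) Nothing here bounds anything: the fibre identification of `DeltaATw`
with `B5Prop11Inverse.Da` at `s′` and the twisted (1.90) are the business of the third file.  (R3) 0 `instance`,
0 `notation`; NOT summit progress (rung R3 of `ym3-torus` is YM₃ on T³ — not d = 4, not a mass gap, not Clay).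
-/

open scoped BigOperators Matrix ComplexConjugate ComplexOrder Matrix.Norms.L2Operator
open Finset Complex

namespace Literature.MathematicalPhysics.QuantumFieldTheory.Balaban1983to89.B5ToronMomentum161

open Literature.MathematicalPhysics.QuantumFieldTheory.Balaban1983to89.B4Strip
open Literature.MathematicalPhysics.QuantumFieldTheory.Balaban1983to89.B5Prop11Fiber
open Literature.MathematicalPhysics.QuantumFieldTheory.Balaban1983to89.B5Prop11Plancherel
open Literature.MathematicalPhysics.QuantumFieldTheory.Balaban1983to89.B5Prop11Lower
open Literature.MathematicalPhysics.QuantumFieldTheory.Balaban1983to89.B5Action121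
open Literature.MathematicalPhysics.QuantumFieldTheory.Balaban1983to89.B5Block118
open Literature.MathematicalPhysics.QuantumFieldTheory.Balaban1983to89.B5Constraint130
open Literature.MathematicalPhysics.QuantumFieldTheory.Balaban1983to89.B5Adjoint130
open Literature.MathematicalPhysics.QuantumFieldTheory.Balaban1983to89.B5FiberZero
open Literature.MathematicalPhysics.QuantumFieldTheory.Balaban1983to89.B5LaplaceSpectral
open Literature.MathematicalPhysics.QuantumFieldTheory.Balaban1983to89.B5LaplaceInverse
open Literature.MathematicalPhysics.QuantumFieldTheory.Balaban1983to89.B5Projection127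
open Literature.MathematicalPhysics.QuantumFieldTheory.Balaban1983to89.B5Substitution125
open Literature.MathematicalPhysics.QuantumFieldTheory.Balaban1983to89.B5Value126
open Literature.MathematicalPhysics.QuantumFieldTheory.Balaban1983to89.B5Momentum130
open Literature.MathematicalPhysics.QuantumFieldTheory.Balaban1983to89.B5Momentum133
open Literature.MathematicalPhysics.QuantumFieldTheory.Balaban1983to89.B5DeltaA169
open Literature.MathematicalPhysics.QuantumFieldTheory.Balaban1983to89.B5ToronOperators118

noncomputable section

/-! ## §1 Twisted symbols on a torus: `∂^ω_ν`, `Δ_ω`, `Δ_ω⁻¹`, `∇^ω_ν` are Fourier multipliers -/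

section Torus

variable {d : ℕ} (N : Fin d → ℕ) [hN : ∀ μ, NeZero (N μ)]

/-- the symbol `c(ω_ν e^{ip·e_ν} − 1)` of the twisted forward difference `∂^ω_ν` — the flat `∂_ν(p)` of (1.31) with
the character value multiplied by the phase. [cite: Balaban1984PropagatorsI, (1.31) p.23; Balaban1985BackgroundPropagators, (3.3) p.391] -/
def ssymTw (c : ℂ) (ω : Fin d → ℂ) (ν : Fin d) : Tor N → ℂ :=
  fun p => c * (ω ν * (ZMod.stdAddChar (N := N ν)) (p ν) - 1)

/-- RECOVERY: `ssymTw … 1 = ssym` ((1.31)). [cite: Balaban1984PropagatorsI, (1.31) p.23] -/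
theorem ssymTw_one (c : ℂ) (ν : Fin d) : ssymTw N c 1 ν = ssym N c ν := by
  funext p
  simp only [ssymTw, ssym, Pi.one_apply, one_mul]

/-- `U ∂^ω_ν = diag(ssymTw) U`: the characters stay eigenvectors of the twisted difference.
[cite: Balaban1984PropagatorsI, (1.29)-(1.31) p.23; Balaban1985BackgroundPropagators, (3.3) p.391] -/
theorem dft_mul_sdiffTw (c : ℂ) (ω : Fin d → ℂ) (ν : Fin d) :
    dft N * sdiffTw N c ω ν = Matrix.diagonal (ssymTw N c ω ν) * dft N := by
  rw [sdiffTw, Matrix.mul_smul, Matrix.mul_sub, Matrix.mul_one, Matrix.mul_smul, dft_mul_shiftS]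
  ext p y
  simp only [Matrix.smul_apply, Matrix.sub_apply, Matrix.diagonal_mul, ssymTw, smul_eq_mul]
  ring

/-- `U (∂^ω_ν)^* = diag(\overline{ssymTw}) U`. [cite: Balaban1984PropagatorsI, (1.31) p.23; Balaban1985BackgroundPropagators, (3.8) p.392] -/
theorem dft_mul_sdiffTwH (c : ℂ) (ω : Fin d → ℂ) (ν : Fin d) :
    dft N * (sdiffTw N c ω ν)ᴴ = Matrix.diagonal (star (ssymTw N c ω ν)) * dft N := by
  have h := dft_mul_sdiffTw N c ω ν
  have hU1 := dft_mul_conjTranspose N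
  have hU2 := dft_conjTranspose_mul N
  have hH : (sdiffTw N c ω ν)ᴴ = (dft N)ᴴ * (Matrix.diagonal (ssymTw N c ω ν))ᴴ * dft N := by
    have h2 := congrArg Matrix.conjTranspose h
    rw [Matrix.conjTranspose_mul, Matrix.conjTranspose_mul] at h2
    calc (sdiffTw N c ω ν)ᴴ = (sdiffTw N c ω ν)ᴴ * ((dft N)ᴴ * dft N) := by rw [hU2, Matrix.mul_one]
      _ = (dft N)ᴴ * (Matrix.diagonal (ssymTw N c ω ν))ᴴ * dft N := by rw [← Matrix.mul_assoc, h2]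
  rw [hH, ← Matrix.mul_assoc, ← Matrix.mul_assoc, hU1, Matrix.one_mul, Matrix.diagonal_conjTranspose]

/-- the symbol `Σ_ν |c(ω_ν e^{ip_ν} − 1)|²` of the twisted scalar Laplace operator `Δ_ω` (the flat «Δ(p) =
Σ_μ|∂_μ(p)|²» of (1.31) at the shifted phases). [cite: Balaban1984PropagatorsI, (1.31) p.23; Balaban1985BackgroundPropagators, (3.23) p.394] -/
def lsymTw (c : ℂ) (ω : Fin d → ℂ) : Tor N → ℂ :=
  fun p => ∑ ν, conj (ssymTw N c ω ν p) * ssymTw N c ω ν p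

/-- RECOVERY: `lsymTw … 1 = lsym`. [cite: Balaban1984PropagatorsI, (1.31) p.23] -/
theorem lsymTw_one (c : ℂ) : lsymTw N c 1 = lsym N c := by
  funext p
  simp only [lsymTw, lsym, ssymTw_one]

/-- `U (∂^ω_ν)^*∂^ω_ν = diag(\overline{ssymTw})·diag(ssymTw) U`. [cite: Balaban1984PropagatorsI, (1.31) p.23] -/
theorem dft_mul_sdiffTwH_mul_sdiffTw (c : ℂ) (ω : Fin d → ℂ) (ν : Fin d) :
    dft N * ((sdiffTw N c ω ν)ᴴ * sdiffTw N c ω ν)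
      = (Matrix.diagonal (ssymTw N c ω ν))ᴴ * Matrix.diagonal (ssymTw N c ω ν) * dft N := by
  rw [← Matrix.mul_assoc, dft_mul_sdiffTwH, Matrix.mul_assoc, dft_mul_sdiffTw, ← Matrix.mul_assoc,
    Matrix.diagonal_conjTranspose]

/-- `U Δ_ω = diag(lsymTw) U`. [cite: Balaban1984PropagatorsI, (1.31) p.23; Balaban1985BackgroundPropagators, (3.23) p.394] -/
theorem dft_mul_LapSTw (c : ℂ) (ω : Fin d → ℂ) :
    dft N * LapSTw N c ω = Matrix.diagonal (lsymTw N c ω) * dft N := by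
  unfold LapSTw
  rw [Finset.mul_sum]
  simp_rw [dft_mul_sdiffTwH_mul_sdiffTw]
  rw [← Finset.sum_mul]
  congr 1
  ext i j
  rw [Matrix.sum_apply]
  simp_rw [Matrix.diagonal_conjTranspose, Matrix.diagonal_mul_diagonal]
  by_cases hij : i = j
  · subst hij
    simp only [Matrix.diagonal_apply_eq, Pi.star_apply, Complex.star_def, lsymTw]
  · simp only [Matrix.diagonal_apply_ne _ hij, Finset.sum_const_zero]

/-- `Δ_ω = U^* diag(lsymTw) U`. [cite: Balaban1985BackgroundPropagators, (3.23) p.394] -/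
theorem LapSTw_eq (c : ℂ) (ω : Fin d → ℂ) :
    LapSTw N c ω = (dft N)ᴴ * Matrix.diagonal (lsymTw N c ω) * dft N := by
  calc LapSTw N c ω = (dft N)ᴴ * dft N * LapSTw N c ω := by rw [dft_conjTranspose_mul, Matrix.one_mul]
    _ = (dft N)ᴴ * Matrix.diagonal (lsymTw N c ω) * dft N := by
        rw [Matrix.mul_assoc, dft_mul_LapSTw, ← Matrix.mul_assoc]

/-- `(Δ_ω f)~(p) = lsymTw(p)·f̃(p)`. [cite: Balaban1985BackgroundPropagators, (3.23) p.394] -/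
theorem dft_LapSTw_apply (c : ℂ) (ω : Fin d → ℂ) (f : Tor N → ℂ) (p : Tor N) :
    (dft N *ᵥ (LapSTw N c ω *ᵥ f)) p = lsymTw N c ω p * (dft N *ᵥ f) p := by
  rw [Matrix.mulVec_mulVec, dft_mul_LapSTw, ← Matrix.mulVec_mulVec, Matrix.mulVec_diagonal]

/-- `lsymTw(p)` is real. [cite: Balaban1984PropagatorsI, (1.31) p.23] -/
theorem conj_lsymTw (c : ℂ) (ω : Fin d → ℂ) (p : Tor N) : conj (lsymTw N c ω p) = lsymTw N c ω p := by
  simp only [lsymTw, map_sum, map_mul, Complex.conj_conj]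
  exact Finset.sum_congr rfl fun ν _ => mul_comm _ _

/-- `lsymTw(p) = Σ_ν |ssymTw_ν(p)|²` as (the cast of) a real number. [cite: Balaban1984PropagatorsI, (1.31) p.23] -/
theorem lsymTw_eq_sum_norm_sq (c : ℂ) (ω : Fin d → ℂ) (p : Tor N) :
    lsymTw N c ω p = ((∑ ν, ‖ssymTw N c ω ν p‖ ^ 2 : ℝ) : ℂ) := by
  simp only [lsymTw]
  push_cast
  refine Finset.sum_congr rfl fun ν _ => ?_
  rw [← Complex.ofReal_pow, Complex.sq_norm, Complex.normSq_eq_conj_mul_self]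

/-- the multiplier of `Δ_ω⁻¹`: `lsymTw(p)⁻¹` where `lsymTw(p) ≠ 0`, `0` on the kernel (B5's convention for `Δ⁻¹`,
p. 22). [cite: Balaban1984PropagatorsI, Sect. C p.22] -/
def linvTw (c : ℂ) (ω : Fin d → ℂ) : Tor N → ℂ :=
  fun p => if lsymTw N c ω p = 0 then 0 else 1 / lsymTw N c ω p

/-- RECOVERY: `linvTw … 1 = linv`. [cite: Balaban1984PropagatorsI, Sect. C p.22] -/
theorem linvTw_one (c : ℂ) : linvTw N c 1 = linv N c := by
  funext p
  simp only [linvTw, linv, lsymTw_one]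

/-- `linvTw(p) = lsymTw(p)⁻¹` (with `0⁻¹ = 0`). [cite: Balaban1984PropagatorsI, Sect. C p.22] -/
theorem linvTw_eq_inv (c : ℂ) (ω : Fin d → ℂ) (p : Tor N) : linvTw N c ω p = (lsymTw N c ω p)⁻¹ := by
  unfold linvTw
  split_ifs with h
  · rw [h, inv_zero]
  · rw [one_div]

/-- **the twisted `Δ⁻¹`**: `Δ_ω⁻¹ := U^* diag(linvTw) U` — «by Δ⁻¹ we denote its inverse on this subspace …
putting its value on constant functions equal to 0» read for `Δ_ω` (inverse on the range, `0` on the kernel; for a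
twist that is not a lattice character the kernel is trivial). [cite: Balaban1984PropagatorsI, Sect. C p.22; Balaban1985BackgroundPropagators, (3.23)-(3.25) p.394] -/
def LapSinvTw (c : ℂ) (ω : Fin d → ℂ) : Matrix (Tor N) (Tor N) ℂ :=
  (dft N)ᴴ * Matrix.diagonal (linvTw N c ω) * dft N

/-- RECOVERY: `Δ_1⁻¹ = Δ⁻¹` (`B5LaplaceInverse.LapSinv`). [cite: Balaban1984PropagatorsI, Sect. C p.22] -/
theorem LapSinvTw_one (c : ℂ) : LapSinvTw N c 1 = LapSinv N c := by
  rw [LapSinvTw, LapSinv, linvTw_one]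

/-- the spectral projection onto `ker Δ_ω`. [cite: Balaban1984PropagatorsI, Sect. C p.22] -/
def PkerTw (c : ℂ) (ω : Fin d → ℂ) : Matrix (Tor N) (Tor N) ℂ :=
  (dft N)ᴴ * Matrix.diagonal (fun p => if lsymTw N c ω p = 0 then (1 : ℂ) else 0) * dft N

/-- RECOVERY: `PkerTw … 1 = Pker`. [cite: Balaban1984PropagatorsI, Sect. C p.22] -/
theorem PkerTw_one (c : ℂ) : PkerTw N c 1 = Pker N c := by
  rw [PkerTw, Pker, lsymTw_one]

/-- `Δ_ωΔ_ω⁻¹ = I − PkerTw`. [cite: Balaban1984PropagatorsI, Sect. C p.22] -/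
theorem LapSTw_mul_LapSinvTw (c : ℂ) (ω : Fin d → ℂ) :
    LapSTw N c ω * LapSinvTw N c ω = 1 - PkerTw N c ω := by
  rw [LapSTw_eq, LapSinvTw, sandwich_mul, PkerTw, one_eq_sandwich, ← Matrix.sub_mul, ← Matrix.mul_sub,
    Matrix.diagonal_sub]
  refine sandwich_congr N fun p => ?_
  by_cases h : lsymTw N c ω p = 0
  · simp only [linvTw, h, if_true, mul_zero, sub_self]
  · simp only [linvTw, h, if_false, sub_zero, mul_one_div_cancel h]

/-- `Δ_ω⁻¹Δ_ω = I − PkerTw`. [cite: Balaban1984PropagatorsI, Sect. C p.22] -/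
theorem LapSinvTw_mul_LapSTw (c : ℂ) (ω : Fin d → ℂ) :
    LapSinvTw N c ω * LapSTw N c ω = 1 - PkerTw N c ω := by
  rw [LapSTw_eq, LapSinvTw, sandwich_mul, PkerTw, one_eq_sandwich, ← Matrix.sub_mul, ← Matrix.mul_sub,
    Matrix.diagonal_sub]
  refine sandwich_congr N fun p => ?_
  by_cases h : lsymTw N c ω p = 0
  · simp only [linvTw, h, if_true, zero_mul, sub_self]
  · simp only [linvTw, h, if_false, sub_zero, one_div_mul_cancel h]

/-- `(Δ_ω⁻¹)ᴴ = Δ_ω⁻¹`. [cite: Balaban1984PropagatorsI, Sect. C p.22] -/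
theorem LapSinvTw_conjTranspose (c : ℂ) (ω : Fin d → ℂ) : (LapSinvTw N c ω)ᴴ = LapSinvTw N c ω := by
  rw [LapSinvTw, sandwich_conjTranspose]
  refine sandwich_congr N fun p => ?_
  simp only [Pi.star_apply, linvTw]
  by_cases h : lsymTw N c ω p = 0
  · rw [if_pos h, star_zero]
  · rw [if_neg h, Complex.star_def, map_div₀, map_one, conj_lsymTw]

/-- `UΔ_ω⁻¹ = diag(linvTw)U`. [cite: Balaban1984PropagatorsI, Sect. C p.22] -/
theorem dft_mul_LapSinvTw (c : ℂ) (ω : Fin d → ℂ) :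
    dft N * LapSinvTw N c ω = Matrix.diagonal (linvTw N c ω) * dft N := by
  rw [LapSinvTw, ← Matrix.mul_assoc, ← Matrix.mul_assoc, dft_mul_conjTranspose, Matrix.one_mul]

/-- `(Δ_ω⁻¹f)~(p) = lsymTw(p)⁻¹·f̃(p)`. [cite: Balaban1984PropagatorsI, Sect. C p.22, (1.32) p.23] -/
theorem dft_LapSinvTw_apply (c : ℂ) (ω : Fin d → ℂ) (f : Tor N → ℂ) (p : Tor N) :
    (dft N *ᵥ (LapSinvTw N c ω *ᵥ f)) p = (lsymTw N c ω p)⁻¹ * (dft N *ᵥ f) p := by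
  rw [Matrix.mulVec_mulVec, dft_mul_LapSinvTw, ← Matrix.mulVec_mulVec, Matrix.mulVec_diagonal,
    linvTw_eq_inv]

/-- the symbol `c(ω_ν e^{2πi p_ν/N_ν} − 1)` of `∇^ω_ν` on vector fields (the twin of `B5Prop11Plancherel.fsym`).
[cite: Balaban1984PropagatorsI, (1.31) p.23; Balaban1985BackgroundPropagators, (3.3) p.391] -/
def fsymTw (c : ℂ) (ω : Fin d → ℂ) (ν : Fin d) (i : Tor N × Fin d) : ℂ :=
  c * (ω ν * (ZMod.stdAddChar (N := N ν)) (i.1 ν) - 1)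

/-- RECOVERY: `fsymTw … 1 = fsym`. [cite: Balaban1984PropagatorsI, (1.31) p.23] -/
theorem fsymTw_one (c : ℂ) (ν : Fin d) : fsymTw N c 1 ν = fsym N c ν := by
  funext i
  simp only [fsymTw, fsym, Pi.one_apply, one_mul]

/-- `fsymTw` is `ssymTw` at the momentum of the index. [cite: Balaban1984PropagatorsI, (1.31) p.23] -/
theorem fsymTw_eq_ssymTw (c : ℂ) (ω : Fin d → ℂ) (ν : Fin d) (i : Tor N × Fin d) :
    fsymTw N c ω ν i = ssymTw N c ω ν i.1 := rfl

/-- `U·(ω S_ν) = diag(ω·e^{2πi p_ν/N_ν})·U` on vector fields (the statement of the `ym3-torus` brick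
`ToronTwistedMultipliers.dftV_mul_twistedShift` under `Summits/`, restated here because `Literature/` cannot import it).
[cite: Balaban1984PropagatorsI, (1.29)-(1.31) p.23] -/
theorem dftV_mul_smul_shiftM (ω : ℂ) (ν : Fin d) :
    dftV N * (ω • shiftM N ν)
      = Matrix.diagonal (fun i : Tor N × Fin d => ω * (ZMod.stdAddChar (N := N ν)) (i.1 ν)) * dftV N := by
  rw [Matrix.mul_smul, dftV_mul_shiftM, ← Matrix.smul_mul]
  congr 1
  ext i j
  by_cases h : i = j
  · subst h; simp
  · simp [h]

/-- **`U ∇^ω_ν = diag(fsymTw) U`**: the twisted forward difference on vector fields is a Fourier multiplier in the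
SAME unitary `dftV` as the flat one. [cite: Balaban1984PropagatorsI, (1.31) p.23; Balaban1985BackgroundPropagators, (3.3) p.391] -/
theorem dftV_mul_fdiffTw (c : ℂ) (ω : Fin d → ℂ) (ν : Fin d) :
    dftV N * fdiffTw N c ω ν = Matrix.diagonal (fsymTw N c ω ν) * dftV N := by
  rw [fdiffTw, Matrix.mul_smul, Matrix.mul_sub, Matrix.mul_one, dftV_mul_smul_shiftM]
  have h : Matrix.diagonal (fsymTw N c ω ν)
      = c • (Matrix.diagonal (fun i : Tor N × Fin d => ω ν * (ZMod.stdAddChar (N := N ν)) (i.1 ν)) - 1) := by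
    ext i j
    by_cases hij : i = j
    · subst hij
      simp [fsymTw]
    · simp [hij]
  rw [h, Matrix.smul_mul, Matrix.sub_mul, Matrix.one_mul]

/-- `∇^ω_ν = U^* diag(fsymTw) U`. [cite: Balaban1984PropagatorsI, (1.31) p.23] -/
theorem fdiffTw_eq (c : ℂ) (ω : Fin d → ℂ) (ν : Fin d) :
    fdiffTw N c ω ν = star (dftV N) * Matrix.diagonal (fsymTw N c ω ν) * dftV N := by
  rw [Matrix.mul_assoc, ← dftV_mul_fdiffTw, ← Matrix.mul_assoc, star_dftV_mul, Matrix.one_mul]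

/-- `(∇^ω_ν)^* = U^* diag(conj fsymTw) U`. [cite: Balaban1984PropagatorsI, (1.31) p.23] -/
theorem star_fdiffTw_eq (c : ℂ) (ω : Fin d → ℂ) (ν : Fin d) :
    star (fdiffTw N c ω ν) = star (dftV N) * Matrix.diagonal (star (fsymTw N c ω ν)) * dftV N := by
  rw [fdiffTw_eq, star_mul, star_mul, star_star, ← Matrix.mul_assoc, Matrix.star_eq_conjTranspose,
    Matrix.star_eq_conjTranspose (Matrix.diagonal _), Matrix.diagonal_conjTranspose,
    ← Matrix.star_eq_conjTranspose]

end Torus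

/-! ## §2 The fine torus: twisted unit factors on the cosets `p = p′ + l` and the twisted momentum
representations (1.30)/(1.61) of `Q′^ω_k`, `Q^ω_k` -/

section Fine

variable {d : ℕ} (n : ℕ) [NeZero n] (M : Fin d → ℕ) [hM : ∀ μ, NeZero (M μ)]

/-- the twisted fine character of `p′ + l` at one step: `omTw ω k q ν = ω_ν · e^{iη(p′_ν + l_ν)}`.
[cite: Balaban1984PropagatorsI, (1.31) p.23] -/
def omTw (ω : Fin d → ℂ) (k : Fin d → Fin n) (q : Tor M) (ν : Fin d) : ℂ := ω ν * om n k (sOf M q) ν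

omit [NeZero n] hM in
/-- RECOVERY: `omTw 1 = om`. [cite: Balaban1984PropagatorsI, (1.31) p.23] -/
theorem omTw_one (k : Fin d → Fin n) (q : Tor M) (ν : Fin d) : omTw n M 1 k q ν = om n k (sOf M q) ν := by
  rw [omTw, Pi.one_apply, one_mul]

/-- on the coset `p = p′ + l`: `ssymTw (fine n M) n ω ν (p′+l) = n(omTw − 1)` (the twisted `∂_ν(p′+l)`).
[cite: Balaban1984PropagatorsI, (1.31) p.23] -/
theorem ssymTw_pOf (ω : Fin d → ℂ) (k : Fin d → Fin n) (q : Tor M) (ν : Fin d) :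
    ssymTw (fine n M) (n : ℂ) ω ν (pOf n M (k, q)) = (n : ℂ) * (omTw n M ω k q ν - 1) := by
  have h := stdAddChar_pOf_mul_natCast n M k q ν 1
  rw [Nat.cast_one, mul_one, pow_one] at h
  rw [ssymTw, omTw, h]

/-- the twisted `v_μ`-factor: `vTw ω k q μ := (1/n) Σ_{t<n} omTw^t` (the normalised straight-contour sum; at a unit
twist it is `∂¹_μ(s′)/∂_μ(s′+l)`, §3). [cite: Balaban1984PropagatorsI, (1.61) p.28] -/
def vTw (ω : Fin d → ℂ) (k : Fin d → Fin n) (q : Tor M) (μ : Fin d) : ℂ :=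
  1 / (n : ℂ) * ∑ t : Fin n, omTw n M ω k q μ ^ (t : ℕ)

/-- the twisted `u`-factor `uTw = Π_ν vTw_ν` (the normalised block sum with transports; at a unit twist it is
`u(s′+l)`, §3). [cite: Balaban1984PropagatorsI, (1.31) p.23] -/
def uTw (ω : Fin d → ℂ) (k : Fin d → Fin n) (q : Tor M) : ℂ := ∏ ν, vTw n M ω k q ν

omit hM in
/-- `Σ_{t<n} omTw^t = n · vTw`. [cite: Balaban1984PropagatorsI, (1.61) p.28] -/
theorem sum_omTw_pow (ω : Fin d → ℂ) (k : Fin d → Fin n) (q : Tor M) (μ : Fin d) :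
    (∑ t : Fin n, omTw n M ω k q μ ^ (t : ℕ)) = (n : ℂ) * vTw n M ω k q μ := by
  have hnc : (n : ℂ) ≠ 0 := by exact_mod_cast NeZero.ne n
  rw [vTw]
  field_simp

omit hM in
/-- RECOVERY: `vTw 1 = v_μ(p′+l)` (`B5Block118.avg_om`). [cite: Balaban1984PropagatorsI, (1.61) p.28] -/
theorem vTw_one (k : Fin d → Fin n) (q : Tor M) (μ : Fin d) : vTw n M 1 k q μ = vSym n k (sOf M q) μ := by
  have hnc : (n : ℂ) ≠ 0 := by exact_mod_cast NeZero.ne n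
  rw [vTw]
  simp_rw [omTw_one]
  rw [avg_om]
  field_simp

omit hM in
/-- RECOVERY: `uTw 1 = u(p′+l)`. [cite: Balaban1984PropagatorsI, (1.31) p.23] -/
theorem uTw_one (k : Fin d → Fin n) (q : Tor M) : uTw n M 1 k q = uSym n k (sOf M q) := by
  simp only [uTw, uSym, vTw_one]

/-- `ω^j · e^{i(p′+l)·ηj} = Π_ν omTw_ν^{j_ν}`: the transport phase combines with the character factorwise.
[cite: Balaban1984PropagatorsI, (1.31) p.23; Balaban1985BackgroundPropagators, (3.19) p.393] -/
theorem twPow_mul_chi_pOf_iota (ω : Fin d → ℂ) (k : Fin d → Fin n) (q : Tor M) (j : Fin d → Fin n) :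
    twPow n ω j * chi (fine n M) (pOf n M (k, q)) (iota n M j) = ∏ ν, omTw n M ω k q ν ^ (j ν : ℕ) := by
  rw [chi_pOf_iota, twPow, ← Finset.prod_mul_distrib]
  refine Finset.prod_congr rfl fun ν _ => ?_
  rw [omTw, mul_pow]

/-- THE TWISTED BLOCK SUM: `Σ_j ω^j e^{i(p′+l)·ηj} = n^d · uTw` (the twin of `B5Block118.sum_chi_iota`).
[cite: Balaban1984PropagatorsI, (1.31) p.23; Balaban1985BackgroundPropagators, (3.19) p.393] -/
theorem sum_twPow_chi_iota (ω : Fin d → ℂ) (k : Fin d → Fin n) (q : Tor M) :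
    ∑ j : Fin d → Fin n, twPow n ω j * chi (fine n M) (pOf n M (k, q)) (iota n M j)
      = (n : ℂ) ^ d * uTw n M ω k q := by
  simp_rw [twPow_mul_chi_pOf_iota]
  rw [← Fintype.piFinset_univ, ← Finset.prod_univ_sum (fun _ => (Finset.univ : Finset (Fin n)))
    (fun ν (t : Fin n) => omTw n M ω k q ν ^ (t : ℕ))]
  simp_rw [sum_omTw_pow]
  rw [Finset.prod_mul_distrib, Finset.prod_const, Finset.card_univ, Fintype.card_fin, uTw]

/-- `ω_μ^t · e^{i(p′+l)·(tηe_μ)} = omTw_μ^t` (transport along the straight contour).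
[cite: Balaban1984PropagatorsI, (1.18) p.20, (1.61) p.28] -/
theorem omega_pow_mul_chi_pOf_tstep (ω : Fin d → ℂ) (k : Fin d → Fin n) (q : Tor M) (μ : Fin d) (t : ℕ) :
    ω μ ^ t * chi (fine n M) (pOf n M (k, q)) (tstep (fine n M) μ t) = omTw n M ω k q μ ^ t := by
  rw [chi_pOf_tstep, omTw, mul_pow]

/-- THE TWISTED MASTER IDENTITY: `Σ_y F¹_{p′,y} Σ_j ω^j g(ny + j + w) = c_Q·n^d Σ_l uTw(p′+l) e^{i(p′+l)·w}
ĝ(p′+l)` (the twin of `B5Block118.master`: Fourier inversion on `T_η`, character orthogonality on `T₁`, the twisted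
block sum). [cite: Balaban1984PropagatorsI, (1.29)-(1.31) p.23; Balaban1985BackgroundPropagators, (3.19) p.393] -/
theorem masterTw (ω : Fin d → ℂ) (g : Tor (fine n M) → ℂ) (q : Tor M) (w : Tor (fine n M)) :
    ∑ y, dft M q y * ∑ j : Fin d → Fin n, twPow n ω j * g (bpt n M y j + w)
      = (cQ n M : ℂ) * (n : ℂ) ^ d * ∑ k : Fin d → Fin n,
          uTw n M ω k q * chi (fine n M) (pOf n M (k, q)) w
            * (dft (fine n M) *ᵥ g) (pOf n M (k, q)) := by
  -- Fourier inversion of `g`, summed along the coset parametrisation `p = p′ + l`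
  have hexp : ∀ (y : Tor M) (j : Fin d → Fin n), g (bpt n M y j + w)
      = ∑ kq : (Fin d → Fin n) × Tor M, (cT (fine n M) : ℂ) * (chi M kq.2 y *
          (chi (fine n M) (pOf n M kq) (iota n M j) * chi (fine n M) (pOf n M kq) w)) *
          (dft (fine n M) *ᵥ g) (pOf n M kq) := by
    intro y j
    rw [dft_inversion (fine n M) g (bpt n M y j + w),
      ← (pOf_bijective n M).sum_comp
        (fun p => conj (dft (fine n M) p (bpt n M y j + w)) * (dft (fine n M) *ᵥ g) p)]
    refine Finset.sum_congr rfl fun kq _ => ?_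
    rcases kq with ⟨k, q'⟩
    simp only
    rw [conj_dft, bpt, chi_add_right, chi_add_right, chi_pOf_up]
    ring
  calc ∑ y, dft M q y * ∑ j : Fin d → Fin n, twPow n ω j * g (bpt n M y j + w)
      = ∑ y, ∑ j : Fin d → Fin n, ∑ kq : (Fin d → Fin n) × Tor M,
          dft M q y * (twPow n ω j * ((cT (fine n M) : ℂ) * (chi M kq.2 y *
            (chi (fine n M) (pOf n M kq) (iota n M j) * chi (fine n M) (pOf n M kq) w)) *
            (dft (fine n M) *ᵥ g) (pOf n M kq))) := by
        refine Finset.sum_congr rfl fun y _ => ?_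
        rw [Finset.mul_sum]
        refine Finset.sum_congr rfl fun j _ => ?_
        rw [hexp, Finset.mul_sum, Finset.mul_sum]
    _ = ∑ y, ∑ kq : (Fin d → Fin n) × Tor M, ∑ j : Fin d → Fin n,
          dft M q y * (twPow n ω j * ((cT (fine n M) : ℂ) * (chi M kq.2 y *
            (chi (fine n M) (pOf n M kq) (iota n M j) * chi (fine n M) (pOf n M kq) w)) *
            (dft (fine n M) *ᵥ g) (pOf n M kq))) :=
        Finset.sum_congr rfl fun y _ => Finset.sum_comm
    _ = ∑ kq : (Fin d → Fin n) × Tor M, ∑ y, ∑ j : Fin d → Fin n,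
          dft M q y * (twPow n ω j * ((cT (fine n M) : ℂ) * (chi M kq.2 y *
            (chi (fine n M) (pOf n M kq) (iota n M j) * chi (fine n M) (pOf n M kq) w)) *
            (dft (fine n M) *ᵥ g) (pOf n M kq))) := Finset.sum_comm
    _ = ∑ kq : (Fin d → Fin n) × Tor M, (cT (fine n M) : ℂ) * (dft (fine n M) *ᵥ g) (pOf n M kq)
          * chi (fine n M) (pOf n M kq) w *
          ((∑ y, dft M q y * chi M kq.2 y) *
            (∑ j : Fin d → Fin n, twPow n ω j * chi (fine n M) (pOf n M kq) (iota n M j))) := by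
        refine Finset.sum_congr rfl fun kq _ => ?_
        rw [Finset.sum_mul_sum, Finset.mul_sum]
        refine Finset.sum_congr rfl fun y _ => ?_
        rw [Finset.mul_sum]
        refine Finset.sum_congr rfl fun j _ => ?_
        ring
    _ = ∑ kq : (Fin d → Fin n) × Tor M, (cT (fine n M) : ℂ) * (dft (fine n M) *ᵥ g) (pOf n M kq)
          * chi (fine n M) (pOf n M kq) w *
          (((cT M : ℂ) * (if kq.2 = q then (Fintype.card (Tor M) : ℂ) else 0)) *
            ((n : ℂ) ^ d * uTw n M ω kq.1 kq.2)) := by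
        refine Finset.sum_congr rfl fun kq _ => ?_
        rcases kq with ⟨k, q'⟩
        congr 2
        · rw [← sum_conj_chi_mul_chi, Finset.mul_sum]
          refine Finset.sum_congr rfl fun y _ => ?_
          rw [dft_apply', mul_assoc]
        · exact sum_twPow_chi_iota n M ω k q'
    _ = (cQ n M : ℂ) * (n : ℂ) ^ d * ∑ k : Fin d → Fin n,
          uTw n M ω k q * chi (fine n M) (pOf n M (k, q)) w
            * (dft (fine n M) *ᵥ g) (pOf n M (k, q)) := by
        rw [Fintype.sum_prod_type, Finset.mul_sum]
        refine Finset.sum_congr rfl fun k _ => ?_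
        rw [Finset.sum_eq_single q]
        · rw [if_pos rfl, cQ]
          push_cast
          ring
        · intro q' _ hq'
          rw [if_neg hq']
          ring
        · intro h
          exact absurd (Finset.mem_univ q) h

/-- **THE TWISTED (1.30) — MOMENTUM REPRESENTATION OF `Q′^ω_k`**: `(Q′^ω_k f)^(p′) = c_Q · Σ_l uTw(p′+l)
f^(p′+l)`, `c_Q = (√(n^d))⁻¹`; at `ω = 1` it is `B5Block118.dft_QsOp`, at a unit twist `uTw = u(s′+l)` (§3).
[cite: Balaban1984PropagatorsI, (1.30) p.23; Balaban1985BackgroundPropagators, (3.19) p.393] -/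
theorem dft_QsOpTw (ω : Fin d → ℂ) (f : Tor (fine n M) → ℂ) (q : Tor M) :
    (dft M *ᵥ (QsOpTw n M ω *ᵥ f)) q
      = (cQ n M : ℂ) * ∑ k : Fin d → Fin n,
          uTw n M ω k q * (dft (fine n M) *ᵥ f) (pOf n M (k, q)) := by
  have hnc : (n : ℂ) ≠ 0 := by exact_mod_cast NeZero.ne n
  have hQ : QsOpTw n M ω *ᵥ f
      = fun y => 1 / (n : ℂ) ^ d * ∑ j : Fin d → Fin n, twPow n ω j * f (bpt n M y j) :=
    funext (QsOpTw_mulVec n M ω f)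
  have hL : (dft M *ᵥ (QsOpTw n M ω *ᵥ f)) q
      = 1 / (n : ℂ) ^ d * ∑ y, dft M q y * ∑ j : Fin d → Fin n, twPow n ω j * f (bpt n M y j + 0) := by
    rw [hQ]
    simp only [Matrix.mulVec, dotProduct, add_zero]
    rw [Finset.mul_sum]
    refine Finset.sum_congr rfl fun y _ => ?_
    ring
  have hm := masterTw n M ω f q 0
  simp only [chi_zero_right, mul_one] at hm
  rw [hL, hm]
  field_simp

/-- **THE TWISTED (1.61) — MOMENTUM REPRESENTATION OF `Q^ω_k`**: `(Q^ω_k A)~_μ(p′) = c_Q · Σ_l uTw(p′+l)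
vTw_μ(p′+l) Ã_μ(p′+l)`; at `ω = 1` it is `B5Block118.dft_QvOp`, at a unit twist `uTw vTw_μ = u(s′+l)v_μ(s′+l)`
(§3). [cite: Balaban1984PropagatorsI, (1.61) p.28; Balaban1985BackgroundPropagators, (3.13)-(3.15) p.393] -/
theorem dft_QvOpTw (ω : Fin d → ℂ) (A : Tor (fine n M) × Fin d → ℂ) (q : Tor M) (μ : Fin d) :
    (dft M *ᵥ comp M (QvOpTw n M ω *ᵥ A) μ) q
      = (cQ n M : ℂ) * ∑ k : Fin d → Fin n,
          uTw n M ω k q * vTw n M ω k q μ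
            * (dft (fine n M) *ᵥ comp (fine n M) A μ) (pOf n M (k, q)) := by
  have hnc : (n : ℂ) ≠ 0 := by exact_mod_cast NeZero.ne n
  have hQ : comp M (QvOpTw n M ω *ᵥ A) μ
      = fun y => 1 / (n : ℂ) ^ (d + 1) *
          ∑ j : Fin d → Fin n, twPow n ω j * lineSumTw n M ω A (bpt n M y j) μ :=
    funext fun y => QvOpTw_mulVec n M ω A y μ
  -- the position-space side, with `Σ_t` outermost
  have hL : (dft M *ᵥ comp M (QvOpTw n M ω *ᵥ A) μ) q
      = 1 / (n : ℂ) ^ (d + 1) * ∑ t : Fin n, ω μ ^ (t : ℕ) * ∑ y, dft M q y *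
          ∑ j : Fin d → Fin n, twPow n ω j *
            comp (fine n M) A μ (bpt n M y j + tstep (fine n M) μ t) := by
    rw [hQ]
    simp only [Matrix.mulVec, dotProduct, lineSumTw, comp]
    simp_rw [Finset.mul_sum]
    conv_rhs => rw [Finset.sum_comm]
    refine Finset.sum_congr rfl fun y _ => ?_
    conv_rhs => rw [Finset.sum_comm]
    refine Finset.sum_congr rfl fun j _ => ?_
    refine Finset.sum_congr rfl fun t _ => ?_
    ring
  rw [hL]
  simp_rw [masterTw]
  have hk : ∀ t : Fin n, ω μ ^ (t : ℕ) * ((cQ n M : ℂ) * (n : ℂ) ^ d *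
      ∑ k : Fin d → Fin n, uTw n M ω k q * chi (fine n M) (pOf n M (k, q)) (tstep (fine n M) μ t)
        * (dft (fine n M) *ᵥ comp (fine n M) A μ) (pOf n M (k, q)))
      = (cQ n M : ℂ) * (n : ℂ) ^ d * ∑ k : Fin d → Fin n,
          uTw n M ω k q * omTw n M ω k q μ ^ (t : ℕ)
            * (dft (fine n M) *ᵥ comp (fine n M) A μ) (pOf n M (k, q)) := by
    intro t
    rw [Finset.mul_sum, Finset.mul_sum, Finset.mul_sum]
    refine Finset.sum_congr rfl fun k _ => ?_
    rw [← omega_pow_mul_chi_pOf_tstep n M ω k q μ t]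
    ring
  simp_rw [hk]
  rw [← Finset.mul_sum, Finset.sum_comm]
  have hk2 : ∀ k : Fin d → Fin n,
      ∑ t : Fin n, uTw n M ω k q * omTw n M ω k q μ ^ (t : ℕ)
          * (dft (fine n M) *ᵥ comp (fine n M) A μ) (pOf n M (k, q))
        = (n : ℂ) * (uTw n M ω k q * vTw n M ω k q μ
          * (dft (fine n M) *ᵥ comp (fine n M) A μ) (pOf n M (k, q))) := by
    intro k
    rw [← Finset.sum_mul, ← Finset.mul_sum, sum_omTw_pow]
    ring
  simp_rw [hk2]
  rw [← Finset.mul_sum]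
  field_simp
  ring

end Fine

/-! ## §2b The adjoint `Q′^ω*` in momentum space (the twisted `\overline{u_k(p)} ω̃(p′)` of (1.30)) -/

section Adjoint

variable {d : ℕ} (n : ℕ) [NeZero n] (M : Fin d → ℕ) [hM : ∀ μ, NeZero (M μ)]

/-- the matrix entry of `Q′^ω_k` at a block point: `(Q′^ω_k)_{y, ny₀+j} = η^d ω^j` if `y₀ = y`, else `0`.
[cite: Balaban1985BackgroundPropagators, (3.19) p.393; Balaban1984PropagatorsI, (1.6) p.18] -/
theorem QsOpTw_apply_bpt (ω : Fin d → ℂ) (y y₀ : Tor M) (j : Fin d → Fin n) :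
    QsOpTw n M ω y (bpt n M y₀ j) = if y₀ = y then twPow n ω j / (n : ℂ) ^ d else 0 := by
  unfold QsOpTw
  by_cases h : y₀ = y
  · subst h
    rw [if_pos rfl, Finset.sum_eq_single j]
    · rw [if_pos rfl]
    · intro j' _ hj
      rw [if_neg]
      intro hb
      have hinj := B5Blocks16.bpt_injective n M (a₁ := (y₀, j)) (a₂ := (y₀, j')) hb
      exact hj (Prod.ext_iff.mp hinj).2.symm
    · intro h0
      exact absurd (Finset.mem_univ j) h0
  · rw [if_neg h]
    refine Finset.sum_eq_zero fun j' _ => ?_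
    rw [if_neg]
    intro hb
    have hinj := B5Blocks16.bpt_injective n M (a₁ := (y₀, j)) (a₂ := (y, j')) hb
    exact h (Prod.ext_iff.mp hinj).1

/-- `(Q′^ω_k)ᴴ g (ny + j) = η^d \overline{ω^j} g(y)`: the adjoint spreads a unit-lattice function over the blocks
with the conjugate transports. [cite: Balaban1985BackgroundPropagators, (3.19) p.393; Balaban1984PropagatorsI, (1.30) p.23] -/
theorem QsOpTw_adjoint_mulVec_bpt (ω : Fin d → ℂ) (g : Tor M → ℂ) (y : Tor M) (j : Fin d → Fin n) :
    ((QsOpTw n M ω)ᴴ *ᵥ g) (bpt n M y j) = conj (twPow n ω j) / (n : ℂ) ^ d * g y := by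
  have hc : star (twPow n ω j / (n : ℂ) ^ d) = conj (twPow n ω j) / (n : ℂ) ^ d := by
    rw [Complex.star_def, map_div₀, map_pow, Complex.conj_natCast]
  rw [Matrix.mulVec, dotProduct, Finset.sum_eq_single y]
  · rw [Matrix.conjTranspose_apply, QsOpTw_apply_bpt, if_pos rfl, hc]
  · intro y' _ hy
    rw [Matrix.conjTranspose_apply, QsOpTw_apply_bpt, if_neg (fun h => hy h.symm), star_zero, zero_mul]
  · intro h0
    exact absurd (Finset.mem_univ _) h0

/-- **THE TWISTED `Q′^ω*` IN MOMENTUM SPACE** — the twin of «\overline{u_k(p)} ω̃(p′)» ((1.30),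
`B5Adjoint130.dft_QsOp_adjoint`): `((Q′^ω_k)ᴴ g)^(p′+l) = c_Q · \overline{uTw(p′+l)} · ĝ(p′)`.
[cite: Balaban1984PropagatorsI, (1.30) p.23; Balaban1985BackgroundPropagators, (3.19) p.393] -/
theorem dft_QsOpTw_adjoint (ω : Fin d → ℂ) (g : Tor M → ℂ) (k : Fin d → Fin n) (q : Tor M) :
    (dft (fine n M) *ᵥ ((QsOpTw n M ω)ᴴ *ᵥ g)) (pOf n M (k, q))
      = (cQ n M : ℂ) * conj (uTw n M ω k q) * (dft M *ᵥ g) q := by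
  have hnc : (n : ℂ) ≠ 0 := by exact_mod_cast NeZero.ne n
  have hsum : (dft (fine n M) *ᵥ ((QsOpTw n M ω)ᴴ *ᵥ g)) (pOf n M (k, q))
      = ∑ y : Tor M, ∑ j : Fin d → Fin n,
          dft (fine n M) (pOf n M (k, q)) (bpt n M y j) * (conj (twPow n ω j) / (n : ℂ) ^ d * g y) := by
    show ∑ x, dft (fine n M) (pOf n M (k, q)) x * ((QsOpTw n M ω)ᴴ *ᵥ g) x = _
    rw [B5Blocks16.sum_blocks n M]
    simp only [QsOpTw_adjoint_mulVec_bpt]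
  have hentry : ∀ (y : Tor M) (j : Fin d → Fin n),
      dft (fine n M) (pOf n M (k, q)) (bpt n M y j)
        = (cT (fine n M) : ℂ) * conj (chi M q y) * conj (chi (fine n M) (pOf n M (k, q)) (iota n M j)) := by
    intro y j
    rw [dft_apply', bpt, chi_add_right, chi_pOf_up, map_mul, mul_assoc]
  have hM' : (dft M *ᵥ g) q = ∑ y, (cT M : ℂ) * conj (chi M q y) * g y := by
    simp only [Matrix.mulVec, dotProduct, dft_apply']
  have hblock : conj (∑ j : Fin d → Fin n, twPow n ω j * chi (fine n M) (pOf n M (k, q)) (iota n M j))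
      = (n : ℂ) ^ d * conj (uTw n M ω k q) := by
    rw [sum_twPow_chi_iota, map_mul, map_pow, Complex.conj_natCast]
  rw [hsum]
  simp_rw [hentry]
  calc ∑ y : Tor M, ∑ j : Fin d → Fin n,
        (cT (fine n M) : ℂ) * conj (chi M q y) * conj (chi (fine n M) (pOf n M (k, q)) (iota n M j))
          * (conj (twPow n ω j) / (n : ℂ) ^ d * g y)
      = ∑ y : Tor M, (cT (fine n M) : ℂ) * conj (chi M q y) * g y / (n : ℂ) ^ d *
          conj (∑ j : Fin d → Fin n, twPow n ω j * chi (fine n M) (pOf n M (k, q)) (iota n M j)) := by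
        refine Finset.sum_congr rfl fun y _ => ?_
        rw [map_sum, Finset.mul_sum]
        refine Finset.sum_congr rfl fun j _ => ?_
        rw [map_mul]
        ring
    _ = (cQ n M : ℂ) * conj (uTw n M ω k q) * (dft M *ᵥ g) q := by
        rw [hblock, hM', Finset.mul_sum, cT_fine]
        refine Finset.sum_congr rfl fun y _ => ?_
        push_cast
        field_simp

end Adjoint

/-! ## §3 Unit twists `ω_ν = e^{iφ_ν}`: every twisted symbol is the flat symbol at the shifted real momentum
`s′ = p′ + nφ` -/

section Phases

variable {d : ℕ} (n : ℕ) [NeZero n] (M : Fin d → ℕ) [hM : ∀ μ, NeZero (M μ)]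

/-- the unit twist with phases `φ`: `ω_ν = e^{iφ_ν}` (for SU(2) torons `φ_ν = ±2θ_ν`).
[cite: Balaban1985BackgroundPropagators, (3.3) p.391] -/
def twistOf (φ : Fin d → ℝ) : Fin d → ℂ := fun ν => Complex.exp (((φ ν : ℝ) : ℂ) * I)

/-- RECOVERY: zero phases give the trivial twist. [cite: Balaban1985BackgroundPropagators, (3.3) p.391] -/
theorem twistOf_zero : twistOf (d := d) 0 = 1 := by
  funext ν
  simp [twistOf]

/-- a unit twist has modulus one. [cite: Balaban1985BackgroundPropagators, (3.3) p.391] -/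
theorem norm_twistOf (φ : Fin d → ℝ) (ν : Fin d) : ‖twistOf φ ν‖ = 1 := by
  rw [twistOf, Complex.norm_exp_ofReal_mul_I]

/-- the shifted real momentum of the coset `p′ ↔ q` under the twist: `s′ = p′ + nφ` (one fine step carries the
phase `φ_ν = η·(nφ_ν)`). [cite: Balaban1984PropagatorsI, (1.31) p.23] -/
def sOfTw (φ : Fin d → ℝ) (q : Tor M) : Fin d → ℝ := sOf M q + fun ν => (n : ℝ) * φ ν

omit [NeZero n] hM in
/-- RECOVERY: `sOfTw … 0 q = sOf q`. [cite: Balaban1984PropagatorsI, (1.31) p.23] -/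
theorem sOfTw_zero (q : Tor M) : sOfTw n M 0 q = sOf M q := by
  funext ν
  simp [sOfTw]

omit hM in
/-- ★ THE SHIFT: the twisted one-step character is the flat one at `s′`: `e^{iφ_ν}·e^{iη(p′_ν+l_ν)} =
e^{iη(s′_ν+l_ν)}`. [cite: Balaban1984PropagatorsI, (1.31) p.23] -/
theorem omTw_twistOf (φ : Fin d → ℝ) (k : Fin d → Fin n) (q : Tor M) (ν : Fin d) :
    omTw n M (twistOf φ) k q ν = om n k (sOfTw n M φ q) ν := by
  have hn : (n : ℂ) ≠ 0 := by exact_mod_cast NeZero.ne n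
  unfold omTw om twistOf sOfTw shiftr
  rw [← Complex.exp_add]
  congr 1
  simp only [Pi.add_apply]
  push_cast
  field_simp
  ring

omit hM in
/-- `Σ_{t<n} e^{iη(s_ν+l_ν)t} = n·v_ν(s+l)` for EVERY real momentum `s` (`B5Block118.avg_om` is the case `s = p′`).
[cite: Balaban1984PropagatorsI, (1.61) p.28] -/
theorem avg_om_of (k : Fin d → Fin n) (s : Fin d → ℝ) (ν : Fin d) :
    (∑ t : Fin n, om n k s ν ^ (t : ℕ)) = (n : ℂ) * vSym n k s ν := by
  have hnc : (n : ℂ) ≠ 0 := by exact_mod_cast NeZero.ne n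
  rw [Fin.sum_univ_eq_sum_range (fun t => om n k s ν ^ t) n]
  by_cases h : om n k s ν = 1
  · have hd : dSym n k s ν = 0 := by rw [dSym_eq_om, h, sub_self, mul_zero]
    rw [vSym, if_pos hd, h]
    simp
  · have h' : om n k s ν - 1 ≠ 0 := sub_ne_zero.mpr h
    have hd : dSym n k s ν ≠ 0 := by
      rw [dSym_eq_om]
      exact mul_ne_zero hnc h'
    rw [geom_sum_eq h, vSym, if_neg hd, d1Sym_eq_om n k, dSym_eq_om]
    field_simp

omit hM in
/-- ★ `vTw` at a unit twist is the flat `v_μ` of (1.61) at `s′`. [cite: Balaban1984PropagatorsI, (1.61) p.28] -/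
theorem vTw_twistOf (φ : Fin d → ℝ) (k : Fin d → Fin n) (q : Tor M) (μ : Fin d) :
    vTw n M (twistOf φ) k q μ = vSym n k (sOfTw n M φ q) μ := by
  have hnc : (n : ℂ) ≠ 0 := by exact_mod_cast NeZero.ne n
  rw [vTw]
  simp_rw [omTw_twistOf]
  rw [avg_om_of]
  field_simp

omit hM in
/-- ★ `uTw` at a unit twist is the flat `u` of (1.31) at `s′`. [cite: Balaban1984PropagatorsI, (1.31) p.23] -/
theorem uTw_twistOf (φ : Fin d → ℝ) (k : Fin d → Fin n) (q : Tor M) :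
    uTw n M (twistOf φ) k q = uSym n k (sOfTw n M φ q) := by
  simp only [uTw, uSym, vTw_twistOf]

/-- ★★ **THE TWISTED DIFFERENCE SYMBOL IS `∂_ν(s′ + l)` OF (1.31)/(1.83)**: `ssymTw (fine n M) n (twistOf φ) ν
(p′+l) = dSym n k s′ ν`, `s′ = p′ + nφ` (the flat case `φ = 0` is `B5Momentum133.ssym_pOf`).
[cite: Balaban1984PropagatorsI, (1.31) p.23, (1.83) p.31] -/
theorem ssymTw_pOf_twistOf (φ : Fin d → ℝ) (k : Fin d → Fin n) (q : Tor M) (ν : Fin d) :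
    ssymTw (fine n M) (n : ℂ) (twistOf φ) ν (pOf n M (k, q)) = dSym n k (sOfTw n M φ q) ν := by
  rw [ssymTw_pOf, omTw_twistOf, dSym_eq_om]

/-- the same on pass 4's coset parametrisation `emb ((k, μ), q) = (pOf (k, q), μ)` for the vector-field symbol.
[cite: Balaban1984PropagatorsI, (1.31) p.23] -/
theorem fsymTw_emb_twistOf (φ : Fin d → ℝ) (k : Fin d → Fin n) (μ : Fin d) (q : Tor M) (ν : Fin d) :
    fsymTw (fine n M) (n : ℂ) (twistOf φ) ν (B5Prop11Plancherel.emb n M ((k, μ), q))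
      = dSym n k (sOfTw n M φ q) ν := by
  rw [fsymTw_eq_ssymTw, emb_eq]
  exact ssymTw_pOf_twistOf n M φ k q ν

/-- ★ the twisted Laplace symbol on the coset is `Δ(s′ + l) = Σ_ν|∂_ν(s′+l)|²` — the `Δ` of the fibre (1.73)/(1.83)
at `s′`. [cite: Balaban1984PropagatorsI, (1.31) p.23, (1.83) p.31] -/
theorem lsymTw_pOf_twistOf (φ : Fin d → ℝ) (k : Fin d → Fin n) (q : Tor M) :
    lsymTw (fine n M) (n : ℂ) (twistOf φ) (pOf n M (k, q))
      = ((DeltaXir n 0 (shiftr n k (sOfTw n M φ q)) : ℝ) : ℂ) := by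
  rw [Delta_eq, lsymTw_eq_sum_norm_sq]
  simp_rw [ssymTw_pOf_twistOf]

/-- twisted (1.30) at a unit twist: `(Q′^ω_k f)^(p′) = c_Q Σ_l u(s′+l) f^(p′+l)`.
[cite: Balaban1984PropagatorsI, (1.30) p.23] -/
theorem dft_QsOpTw_twistOf (φ : Fin d → ℝ) (f : Tor (fine n M) → ℂ) (q : Tor M) :
    (dft M *ᵥ (QsOpTw n M (twistOf φ) *ᵥ f)) q
      = (cQ n M : ℂ) * ∑ k : Fin d → Fin n,
          uSym n k (sOfTw n M φ q) * (dft (fine n M) *ᵥ f) (pOf n M (k, q)) := by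
  rw [dft_QsOpTw]
  simp_rw [uTw_twistOf]

/-- twisted (1.61) at a unit twist: `(Q^ω_k A)~_μ(p′) = c_Q Σ_l u(s′+l) v_μ(s′+l) Ã_μ(p′+l)`.
[cite: Balaban1984PropagatorsI, (1.61) p.28] -/
theorem dft_QvOpTw_twistOf (φ : Fin d → ℝ) (A : Tor (fine n M) × Fin d → ℂ) (q : Tor M) (μ : Fin d) :
    (dft M *ᵥ comp M (QvOpTw n M (twistOf φ) *ᵥ A) μ) q
      = (cQ n M : ℂ) * ∑ k : Fin d → Fin n,
          uSym n k (sOfTw n M φ q) * vSym n k (sOfTw n M φ q) μ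
            * (dft (fine n M) *ᵥ comp (fine n M) A μ) (pOf n M (k, q)) := by
  rw [dft_QvOpTw]
  simp_rw [uTw_twistOf, vTw_twistOf]

end Phases

/-! ## §4 The twisted `Q*`, `Q′Δ⁻²Q′*`, its pseudo-inverse, `P` and `Δ_a` -/

section Defs

variable {d : ℕ} (n : ℕ) [NeZero n] (M : Fin d → ℕ) [hM : ∀ μ, NeZero (M μ)]

/-- the twisted `Q*_k`: `η^{−d}` times the conjugate transpose of `Q^ω_k` (the normalisation of
`B5DeltaA169.QvAdj`, fixed in the flat case by (1.74)). [cite: Balaban1984PropagatorsI, (1.69) p.29, (1.74) p.30; Balaban1985BackgroundPropagators, (3.16) p.393] -/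
def QvAdjTw (ω : Fin d → ℂ) : Matrix (Tor (fine n M) × Fin d) (Tor M × Fin d) ℂ :=
  ((n : ℂ) ^ d) • (QvOpTw n M ω)ᴴ

omit [NeZero n] hM in
/-- RECOVERY: `QvAdjTw … 1 = QvAdj`. [cite: Balaban1984PropagatorsI, (1.69) p.29] -/
theorem QvAdjTw_one : QvAdjTw n M 1 = QvAdj n M := by
  rw [QvAdjTw, QvAdj, QvOpTw_one]

omit [NeZero n] in
/-- `Q^ω*_k B = η^{−d}(Q^ω_k)ᴴ B`. [cite: Balaban1984PropagatorsI, (1.69) p.29] -/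
theorem QvAdjTw_mulVec (ω : Fin d → ℂ) (B : Tor M × Fin d → ℂ) :
    QvAdjTw n M ω *ᵥ B = ((n : ℂ) ^ d) • ((QvOpTw n M ω)ᴴ *ᵥ B) := by
  rw [QvAdjTw, Matrix.smul_mulVec]

variable (c : ℂ)

/-- the twisted `Q′_kΔ⁻²Q′*_k` (the operator inverted in (1.70)/(3.25)). [cite: Balaban1984PropagatorsI, Sect. C p.22, (1.70) p.30; Balaban1985BackgroundPropagators, (3.25) p.394] -/
def MopTw (ω : Fin d → ℂ) : Matrix (Tor M) (Tor M) ℂ :=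
  QsOpTw n M ω * (LapSinvTw (fine n M) c ω * LapSinvTw (fine n M) c ω) * (QsOpTw n M ω)ᴴ

/-- RECOVERY: `MopTw … 1 = Mop` (`B5Substitution125.Mop`). [cite: Balaban1984PropagatorsI, Sect. C p.22] -/
theorem MopTw_one : MopTw n M c 1 = Mop n M c := by
  rw [MopTw, Mop, QsOpTw_one, LapSinvTw_one]

/-- `MopTw g = Q′^ωΔ_ω⁻¹(Δ_ω⁻¹(Q′^ω* g))`. [cite: Balaban1984PropagatorsI, Sect. C p.22] -/
theorem MopTw_mulVec (ω : Fin d → ℂ) (g : Tor M → ℂ) :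
    MopTw n M c ω *ᵥ g
      = QsOpTw n M ω *ᵥ (LapSinvTw (fine n M) c ω *ᵥ
          (LapSinvTw (fine n M) c ω *ᵥ ((QsOpTw n M ω)ᴴ *ᵥ g))) := by
  rw [MopTw, ← Matrix.mulVec_mulVec, ← Matrix.mulVec_mulVec, ← Matrix.mulVec_mulVec]

/-- the coarse symbol of `MopTw`: the twisted `Σ_l |u(p′+l)|²/Δ²(p′+l)` of (1.33) (with `0⁻¹ = 0` at kernel
modes). [cite: Balaban1984PropagatorsI, (1.33) p.23] -/
def XsTw (ω : Fin d → ℂ) (q : Tor M) : ℂ :=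
  ∑ k : Fin d → Fin n,
    uTw n M ω k q * conj (uTw n M ω k q) * (lsymTw (fine n M) c ω (pOf n M (k, q)))⁻¹ ^ 2

/-- `(MopTw g)^(p′) = c_Q² · XsTw(p′) · ĝ(p′)` — the twin of `B5Momentum133.dft_Mop_apply`.
[cite: Balaban1984PropagatorsI, (1.30)-(1.33) p.23] -/
theorem dft_MopTw_apply (ω : Fin d → ℂ) (g : Tor M → ℂ) (q : Tor M) :
    (dft M *ᵥ (MopTw n M c ω *ᵥ g)) q = (cQ n M : ℂ) ^ 2 * XsTw n M c ω q * (dft M *ᵥ g) q := by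
  rw [MopTw_mulVec, dft_QsOpTw]
  simp_rw [dft_LapSinvTw_apply, dft_QsOpTw_adjoint]
  rw [XsTw, Finset.mul_sum, Finset.mul_sum, Finset.sum_mul]
  refine Finset.sum_congr rfl fun k _ => ?_
  ring

/-- RECOVERY: `XsTw … 1 = Xs` (the printed normalising sum of (1.33)). [cite: Balaban1984PropagatorsI, (1.33) p.23] -/
theorem XsTw_one (q : Tor M) : XsTw n M c 1 q = Xs n M c q := by
  rw [XsTw, Xs]
  refine Finset.sum_congr rfl fun k _ => ?_
  rw [uTw_one, lsymTw_one, Complex.mul_conj, Complex.normSq_eq_norm_sq, div_eq_mul_inv, inv_pow]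

/-- **the twisted `(Q′_kΔ⁻²Q′*_k)⁻¹`**: the pseudo-inverse of `MopTw` in the unit-lattice Fourier basis,
`U^* diag((c_Q²XsTw)⁻¹) U` (`0⁻¹ = 0`; the inverse whenever `MopTw` has no kernel, i.e. for every twist that is not
a lattice character). [cite: Balaban1984PropagatorsI, (1.70) p.30, (1.33) p.23; Balaban1985BackgroundPropagators, (3.25) p.394] -/
def MinvTw (ω : Fin d → ℂ) : Matrix (Tor M) (Tor M) ℂ :=
  (dft M)ᴴ * Matrix.diagonal (fun q => ((cQ n M : ℂ) ^ 2 * XsTw n M c ω q)⁻¹) * dft M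

/-- `(MinvTw g)^(p′) = (c_Q²XsTw(p′))⁻¹ ĝ(p′)`. [cite: Balaban1984PropagatorsI, (1.33) p.23] -/
theorem dft_MinvTw_apply (ω : Fin d → ℂ) (g : Tor M → ℂ) (q : Tor M) :
    (dft M *ᵥ (MinvTw n M c ω *ᵥ g)) q = ((cQ n M : ℂ) ^ 2 * XsTw n M c ω q)⁻¹ * (dft M *ᵥ g) q := by
  have h : dft M * MinvTw n M c ω
      = Matrix.diagonal (fun q => ((cQ n M : ℂ) ^ 2 * XsTw n M c ω q)⁻¹) * dft M := by
    rw [MinvTw, ← Matrix.mul_assoc, ← Matrix.mul_assoc, dft_mul_conjTranspose, Matrix.one_mul]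
  rw [Matrix.mulVec_mulVec, h, ← Matrix.mulVec_mulVec, Matrix.mulVec_diagonal]

/-- RECOVERY on the relevant subspace: on unit-lattice functions `g ⊥ 1` the twisted pseudo-inverse at `ω = 1`
IS the flat `(Q′_kΔ⁻²Q′*_k)⁻¹` of `B5Substitution125` (`= (Mop + C)⁻¹`, `C` the projection onto constants)
(`c ≠ 0`). [cite: Balaban1984PropagatorsI, Sect. C p.22, (1.33) p.23] -/
theorem MinvTw_one_mulVec_of_orth (hc : c ≠ 0) (g : Tor M → ℂ) (hg : ∑ y, g y = 0) :
    MinvTw n M c 1 *ᵥ g = Minv n M c *ᵥ g := by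
  have key : dft M *ᵥ (MinvTw n M c 1 *ᵥ g) = dft M *ᵥ (Minv n M c *ᵥ g) := by
    funext q
    rw [dft_MinvTw_apply, XsTw_one]
    by_cases hq : q = 0
    · subst hq
      rw [dft_zero_apply M g, hg, mul_zero, mul_zero, dft_zero_apply,
        sum_Minv_of_orth n M c hc g hg, mul_zero]
    · have hm : (cQ n M : ℂ) ^ 2 * Xs n M c q ≠ 0 :=
        mul_ne_zero (pow_ne_zero _ (cQ_ne_zero n M)) (Xs_ne_zero n M c hc hq)
      have h := dft_Mop_apply n M c (Minv n M c *ᵥ g) q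
      rw [Mop_Minv_of_orth n M c hc g hg] at h
      rw [h, ← mul_assoc, inv_mul_cancel₀ hm, one_mul]
  have h0 : MinvTw n M c 1 *ᵥ g - Minv n M c *ᵥ g = 0 :=
    dft_mulVec_eq_zero M _ (by rw [Matrix.mulVec_sub, key, sub_self])
  exact sub_eq_zero.mp h0

/-- **THE TWISTED `P` OF (1.70)/(3.25)**: `P^ω := Δ_ω⁻¹Q′^ω*·(Q′^ωΔ_ω⁻²Q′^ω*)⁻¹·Q′^ωΔ_ω⁻¹` with the typed twisted
letters (pass 18's abstract `Pc`). [cite: Balaban1984PropagatorsI, (1.26) p.22, (1.70) p.30; Balaban1985BackgroundPropagators, (3.25) p.394] -/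
def PcTTw (ω : Fin d → ℂ) : Matrix (Tor (fine n M)) (Tor (fine n M)) ℂ :=
  Pc (LapSinvTw (fine n M) c ω) (QsOpTw n M ω) (MinvTw n M c ω)

/-- `P^ω b = Δ_ω⁻¹(Q′^ω*((Q′^ωΔ_ω⁻²Q′^ω*)⁻¹(Q′^ω(Δ_ω⁻¹b))))`. [cite: Balaban1984PropagatorsI, (1.70) p.30] -/
theorem PcTTw_mulVec (ω : Fin d → ℂ) (b : Tor (fine n M) → ℂ) :
    PcTTw n M c ω *ᵥ b
      = LapSinvTw (fine n M) c ω *ᵥ ((QsOpTw n M ω)ᴴ *ᵥ (MinvTw n M c ω *ᵥ (QsOpTw n M ω *ᵥ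
          (LapSinvTw (fine n M) c ω *ᵥ b)))) := by
  simp only [PcTTw, Pc, ← Matrix.mulVec_mulVec]

/-- at lattice factor `c = 0` every difference symbol vanishes, so `Δ_ω⁻¹ = 0`. [cite: Balaban1984PropagatorsI, Sect. C p.22] -/
theorem LapSinvTw_zero_c {N : Fin d → ℕ} [∀ μ, NeZero (N μ)] (ω : Fin d → ℂ) : LapSinvTw N 0 ω = 0 := by
  have h : linvTw N 0 ω = fun _ => 0 := by
    funext p
    have hl : lsymTw N 0 ω p = 0 := by simp [lsymTw, ssymTw]
    simp [linvTw, hl]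
  rw [LapSinvTw, h]
  simp

/-- **RECOVERY: `P^1 = P`** — the twisted projection at `ω = 1` IS `B5Value126.PcT` (every `c`; for `c ≠ 0` because
`Q′Δ⁻¹b ⊥ 1` and the two middle inverses agree there, for `c = 0` both sides vanish).
[cite: Balaban1984PropagatorsI, (1.26) p.22, (1.70) p.30] -/
theorem PcTTw_one : PcTTw n M c 1 = PcT n M c := by
  by_cases hc : c = 0
  · subst hc
    have h1 : LapSinv (fine n M) 0 = 0 := by rw [← LapSinvTw_one, LapSinvTw_zero_c]
    rw [PcTTw, PcT, Pc, Pc, LapSinvTw_zero_c, h1]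
    simp
  · refine ext_of_mulVec fun b => ?_
    rw [PcTTw_mulVec, PcT_mulVec, LapSinvTw_one, QsOpTw_one,
      MinvTw_one_mulVec_of_orth n M c hc _ (sum_QsOp_LapSinv n M c b)]

variable (a : ℝ)

/-- **THE TWISTED `Δ_a` OF (1.69)/(1.73)**: `Δ^ω_a := Δ_ω − ∂^ωP^ω(∂^ω)ᴴ + a·Q^ω*Q^ω` on vector functions on `T_η`
(`η = 1/n`, lattice factor `c = n`) — literally `B5DeltaA169.DeltaA` with every letter replaced by its twin; the
quadratic form of the second-order expansion (3.7)/(3.10) plus the gauge-fixing and averaging terms (3.16)/(3.20) at a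
constant abelian background on a charged sector. [cite: Balaban1984PropagatorsI, (1.69) p.29, (1.73) p.30; Balaban1985BackgroundPropagators, (3.10) p.392, (3.16) p.393, (3.25) p.394] -/
def DeltaATw (ω : Fin d → ℂ) : Matrix (Tor (fine n M) × Fin d) (Tor (fine n M) × Fin d) ℂ :=
  LapTw n M ω - GradOpTw (fine n M) (n : ℂ) ω * PcTTw n M (n : ℂ) ω * (GradOpTw (fine n M) (n : ℂ) ω)ᴴ
    + (a : ℂ) • (QvAdjTw n M ω * QvOpTw n M ω)

/-- ★★★ **RECOVERY: `Δ^1_a = Δ_a`** — at the trivial twist the toron twin IS `B5DeltaA169.DeltaA`.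
[cite: Balaban1984PropagatorsI, (1.69) p.29, (1.73) p.30] -/
theorem DeltaATw_one : DeltaATw n M a 1 = DeltaA n M a := by
  rw [DeltaATw, DeltaA, LapTw_one, GradOpTw_one, PcTTw_one, QvAdjTw_one, QvOpTw_one]

/-- the left-hand side of the twisted (1.73): `Δ^ω_a A = Δ_ωA − ∂^ω(P^ω((∂^ω)ᴴA)) + a·η^{−d}(Q^ω)ᴴ(Q^ωA)`.
[cite: Balaban1984PropagatorsI, (1.73) p.30] -/
theorem DeltaATw_mulVec (ω : Fin d → ℂ) (A : Tor (fine n M) × Fin d → ℂ) :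
    DeltaATw n M a ω *ᵥ A
      = LapTw n M ω *ᵥ A
        - GradOpTw (fine n M) (n : ℂ) ω *ᵥ (PcTTw n M (n : ℂ) ω *ᵥ
            ((GradOpTw (fine n M) (n : ℂ) ω)ᴴ *ᵥ A))
        + ((a : ℂ) * (n : ℂ) ^ d) • ((QvOpTw n M ω)ᴴ *ᵥ (QvOpTw n M ω *ᵥ A)) := by
  rw [DeltaATw, Matrix.add_mulVec, Matrix.sub_mulVec, Matrix.smul_mulVec,
    ← Matrix.mulVec_mulVec, ← Matrix.mulVec_mulVec, ← Matrix.mulVec_mulVec, QvAdjTw_mulVec,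
    smul_smul]

/-- **the twisted (1.69), first form: `Δ^ω_a = (∂^ω)^*∂^ω + ∂^ωR^ω(∂^ω)^* + aQ^ω*Q^ω`, `R^ω = I − P^ω`**, with
`(∂^ω)^*∂^ω` on vector functions = `½(CurlOpTw)ᴴCurlOpTw` (`B5ToronOperators118.curlTw_adjoint_curlTw`) — the form
[B9] (3.26) «⟨A, Δ_aA⟩ = ⟨DA, DA⟩ + ⟨RD*A, RD*A⟩ + ⟨A, Q*aQA⟩» at a constant abelian background (`Δ′ = 0`).
[cite: Balaban1984PropagatorsI, (1.69) p.29; Balaban1985BackgroundPropagators, (3.26) p.395] -/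
theorem DeltaATw_eq_curl (ω : Fin d → ℂ) :
    DeltaATw n M a ω
      = (1 / 2 : ℂ) • ((CurlOpTw (fine n M) (n : ℂ) ω)ᴴ * CurlOpTw (fine n M) (n : ℂ) ω)
        + GradOpTw (fine n M) (n : ℂ) ω * (1 - PcTTw n M (n : ℂ) ω) * (GradOpTw (fine n M) (n : ℂ) ω)ᴴ
        + (a : ℂ) • (QvAdjTw n M ω * QvOpTw n M ω) := by
  have h := curlTw_adjoint_curlTw (fine n M) (n : ℂ) ω
  have h2 : (1 / 2 : ℂ) • ((CurlOpTw (fine n M) (n : ℂ) ω)ᴴ * CurlOpTw (fine n M) (n : ℂ) ω)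
      = LapVTw (fine n M) (n : ℂ) ω
        - GradOpTw (fine n M) (n : ℂ) ω * (GradOpTw (fine n M) (n : ℂ) ω)ᴴ := by
    rw [h, smul_smul]
    norm_num
  rw [h2, DeltaATw, LapTw_eq_LapVTw, Matrix.mul_sub, Matrix.mul_one, Matrix.sub_mul]
  abel

end Defs

end

end Literature.MathematicalPhysics.QuantumFieldTheory.Balaban1983to89.B5ToronMomentum161
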